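import Mathlib
import HarnessLib

/-!
# Floquet import bookkeeping: whole-period imports of a real-multiplier Floquet mode are one-signed

HONEST FRAMING (cell `ns-blowup`, seat `ns-blowup-instab`, human ruling D-0035): nothing here is a
claim about Navier–Stokes blow-up. WHAT THIS IS NOT: not a statement about the marginal tower N1*;
it is the elementary real analysis behind `instab/X1pp-SKENE-TOBIAS.md` §2(c)(d), i.e. how the
planner's X1″ grading items H3 (sign coherence κ = 1 over ≥ 4 host periods) and H4 (amount vs
floor) read for an X0-FLOQUET channel — a Floquet mode with POSITIVE REAL multiplier `μ = e^{γT}`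
about a `T`-periodic host, whose adapted-disc flux is `Γ(t) = ε e^{γt} F(t)` with `F` `T`-periodic
(the normalised flux of the periodic Floquet factor):

* `flux_add_period`, `periodImport_eq`: the import over the `j`-th whole period starting at phase
  `φ`, `Γ(φ + (j+1)T) − Γ(φ + jT)`, equals `ε F(φ) e^{γ(φ + jT)} (e^{γT} − 1)`;
* `periodImport_pos`, `periodImport_neg`: for `γ > 0`, `ε > 0` its sign is the sign of `F(φ)` for
  EVERY `j` — H3's «|Σ_j F_j| ≥ 0.8 Σ_j |F_j|» holds with equality 1 for any such mode and carries
  no information; the informative criterion is INTRA-period: `flux_sign_change_every_period` — if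
  `F` takes both signs within a period then `Γ` changes sign inside every period (a growing
  standing oscillation, not a co-signed accumulating child);
* `floor_reached_iff`: H4 for an exponential channel — `ε F e^{γt} ≥ m ↔ t ≥ log(m/(εF))/γ`
  (`γ, ε F, m > 0`): any rate `γ` bounded below along the tower meets any power-law floor inside a
  power-law window, so H4 reduces to «γ/σ_α bounded below as Re → ∞» (memo §2(d)).

References: G. Floquet, Ann. ÉNS 12 (1883) 47; cell files `plan/PENDING-RULINGS.md` v2.3 H1–H6,
`instab/X1pp-SKENE-TOBIAS.md` §2.
-/

namespace Summit.NavierStokesRegularity.FluidComputer.FloquetImportBookkeeping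

open Real

/-- The flux of a real-multiplier Floquet mode one period later: `Γ(t + T) = e^{γT} Γ(t)` for
`Γ(t) = ε e^{γt} F(t)` with `F` `T`-periodic. -/
theorem flux_add_period {F : ℝ → ℝ} {T : ℝ} (hF : ∀ t, F (t + T) = F t) (ε γ t : ℝ) :
    ε * exp (γ * (t + T)) * F (t + T) = exp (γ * T) * (ε * exp (γ * t) * F t) := by
  rw [hF t, mul_add, exp_add]
  ring

/-- Iterating: `Γ(φ + jT) = e^{γ jT} Γ(φ)`, written out. -/
theorem flux_add_nat_mul_period {F : ℝ → ℝ} {T : ℝ} (hF : ∀ t, F (t + T) = F t) (ε γ φ : ℝ)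
    (j : ℕ) : ε * exp (γ * (φ + j * T)) * F (φ + j * T) = ε * F φ * exp (γ * (φ + j * T)) := by
  have hFj : ∀ n : ℕ, F (φ + n * T) = F φ := by
    intro n
    induction n with
    | zero => simp
    | succ n ih =>
      have : φ + (↑(n + 1) : ℝ) * T = (φ + n * T) + T := by push_cast; ring
      rw [this, hF, ih]
  rw [hFj j]
  ring

/-- **Whole-period import.** The import over the `j`-th whole period starting at phase `φ`:
`Γ(φ + (j+1)T) − Γ(φ + jT) = ε F(φ) e^{γ(φ + jT)} (e^{γT} − 1)`. -/
theorem periodImport_eq {F : ℝ → ℝ} {T : ℝ} (hF : ∀ t, F (t + T) = F t) (ε γ φ : ℝ) (j : ℕ) :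
    ε * exp (γ * (φ + (j + 1 : ℕ) * T)) * F (φ + (j + 1 : ℕ) * T) -
        ε * exp (γ * (φ + j * T)) * F (φ + j * T) =
      ε * F φ * exp (γ * (φ + j * T)) * (exp (γ * T) - 1) := by
  rw [flux_add_nat_mul_period hF ε γ φ (j + 1), flux_add_nat_mul_period hF ε γ φ j]
  have : γ * (φ + (↑(j + 1) : ℝ) * T) = γ * (φ + j * T) + γ * T := by push_cast; ring
  rw [this, exp_add]
  ring

/-- **H3 is free for a growing positive-real-multiplier mode (positive sign).** If `γ > 0`, `T > 0`,
`ε > 0` and `F(φ) > 0`, every whole-period import starting at phase `φ` is positive. -/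
theorem periodImport_pos {F : ℝ → ℝ} {T ε γ φ : ℝ} (hF : ∀ t, F (t + T) = F t) (hT : 0 < T)
    (hγ : 0 < γ) (hε : 0 < ε) (hφ : 0 < F φ) (j : ℕ) :
    0 < ε * exp (γ * (φ + (j + 1 : ℕ) * T)) * F (φ + (j + 1 : ℕ) * T) -
        ε * exp (γ * (φ + j * T)) * F (φ + j * T) := by
  rw [periodImport_eq hF]
  have h1 : 0 < exp (γ * T) - 1 := by
    have : 1 < exp (γ * T) := Real.one_lt_exp_iff.mpr (mul_pos hγ hT)
    linarith
  positivity

/-- … and (negative sign): if `F(φ) < 0` every whole-period import starting at phase `φ` is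
negative — the sign of ALL period imports is the sign of `F` at the chosen phase origin. -/
theorem periodImport_neg {F : ℝ → ℝ} {T ε γ φ : ℝ} (hF : ∀ t, F (t + T) = F t) (hT : 0 < T)
    (hγ : 0 < γ) (hε : 0 < ε) (hφ : F φ < 0) (j : ℕ) :
    ε * exp (γ * (φ + (j + 1 : ℕ) * T)) * F (φ + (j + 1 : ℕ) * T) -
        ε * exp (γ * (φ + j * T)) * F (φ + j * T) < 0 := by
  rw [periodImport_eq hF]
  have h1 : 0 < exp (γ * T) - 1 := by
    have : 1 < exp (γ * T) := Real.one_lt_exp_iff.mpr (mul_pos hγ hT)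
    linarith
  have h2 : 0 < ε * exp (γ * (φ + j * T)) * (exp (γ * T) - 1) := by positivity
  have : ε * F φ * exp (γ * (φ + j * T)) * (exp (γ * T) - 1) =
      F φ * (ε * exp (γ * (φ + j * T)) * (exp (γ * T) - 1)) := by ring
  rw [this]
  exact mul_neg_of_neg_of_pos hφ h2

/-- **The informative criterion is intra-period.** If the periodic factor takes both signs,
`F(φ₁) > 0 > F(φ₂)`, then the flux `Γ(t) = ε e^{γt} F(t)` (`ε > 0`) changes sign inside EVERY
period: `Γ(φ₁ + jT) > 0 > Γ(φ₂ + jT)` for all `j` — a growing standing oscillation of the core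
flux, not a co-signed accumulating child, even though all whole-period imports are one-signed. -/
theorem flux_sign_change_every_period {F : ℝ → ℝ} {T ε γ φ₁ φ₂ : ℝ} (hF : ∀ t, F (t + T) = F t)
    (hε : 0 < ε) (h₁ : 0 < F φ₁) (h₂ : F φ₂ < 0) (j : ℕ) :
    0 < ε * exp (γ * (φ₁ + j * T)) * F (φ₁ + j * T) ∧
      ε * exp (γ * (φ₂ + j * T)) * F (φ₂ + j * T) < 0 := by
  rw [flux_add_nat_mul_period hF ε γ φ₁ j, flux_add_nat_mul_period hF ε γ φ₂ j]
  refine ⟨by positivity, ?_⟩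
  have : ε * F φ₂ * exp (γ * (φ₂ + j * T)) = F φ₂ * (ε * exp (γ * (φ₂ + j * T))) := by ring
  rw [this]
  exact mul_neg_of_neg_of_pos h₂ (by positivity)

/-- **H4 for an exponential channel.** With `γ > 0`, `εF > 0`, `m > 0`: the flux `εF e^{γt}`
reaches the floor `m` exactly from time `log(m/(εF))/γ` on. -/
theorem floor_reached_iff {γ c m t : ℝ} (hγ : 0 < γ) (hc : 0 < c) (hm : 0 < m) :
    m ≤ c * exp (γ * t) ↔ Real.log (m / c) / γ ≤ t := by
  rw [div_le_iff₀ hγ]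
  constructor
  · intro h
    have h' : m / c ≤ exp (γ * t) := by rw [div_le_iff₀ hc, mul_comm]; exact h
    have := Real.log_le_log (div_pos hm hc) h'
    rw [Real.log_exp] at this
    linarith
  · intro h
    have h' : Real.log (m / c) ≤ γ * t := by linarith
    have : m / c ≤ exp (γ * t) := by
      rw [← Real.log_le_log_iff (div_pos hm hc) (exp_pos _), Real.log_exp]
      exact h'
    rw [div_le_iff₀ hc] at this
    linarith

/-- Consequence used in the memo (§2(d)): if the window length `T_w` satisfies
`log(m/(εF)) ≤ γ T_w`, the floor is met within the window. Any `γ` bounded below along the tower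
meets a power-law floor `m = m(N)` inside a power-law window `T_w(N)` for `N` large, since the
left side grows like `log N` and the right like a power of `N`. -/
theorem floor_within_window {γ c m Tw : ℝ} (hγ : 0 < γ) (hc : 0 < c) (hm : 0 < m)
    (h : Real.log (m / c) ≤ γ * Tw) : m ≤ c * exp (γ * Tw) := by
  rw [floor_reached_iff hγ hc hm, div_le_iff₀ hγ]
  linarith

end Summit.NavierStokesRegularity.FluidComputer.FloquetImportBookkeeping
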